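import Summits.ValiantsHypothesis.ValiantsHypothesis.Theorems.KPlusLogSqLawTropicalShiftGrid

/-!
# Route «KPlusLogSqLaw» — SHIFT-GRID, part 2: dominance, signs, the chain; EVERY RANK-TWO GAP ROW IS EXACTLY `(A·m+1)(E·m+1) − 1`

HONEST FRAMING.  Second proof file (pure theorems) of the helper chain `--supports` the crux
`Summit.ValiantsHypothesis.ValiantsHypothesis.Theses.KPlusLogSqLaw.TropicalB` (item `stmt-ValiantsHypothesis-19771`, route `KPlusLogSqLaw`;
cell `pub-symmetroid`, seat val-sym-trop-p5 g8, 2026-08-27); design in `…TropicalShiftGridDefs.lean`, part 1 in `…TropicalShiftGrid.lean`; the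
domination inequalities (`gval_gap_of_lt/gt`, `bonus_shift`, `bonus_le_lvl`, `bonus_lt_lvl`) and the sign products (`prod_neg_one_pow_lvl`,
`prod_ite_high`) are SHIFT-LADDER's, reused verbatim.  Proved here, sorry-free:
* `ShiftGrid.cell_of_eshift_eq`: an incidence of effective shift `p ≤ E·m` sits on the rotation-`(p mod m)` entry of its column with the grid's
  high digit (`shift − (p mod m)` is a multiple of `m` of absolute value `≤ n`, hence zero);
* `ShiftGrid.isDominant_cterm`: for ALL `p ≤ E·m`, `a ≤ A·m` the grid term is the UNIQUE optimum at `θ(p,a) = 2(W·p + a) + 1` among all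
  `m!·((A+1)(E+1))^m` Leibniz terms;
* `ShiftGrid.termSign_cterm`: its sign is `(−1)^{W·p + a}` exactly (`sign σ = (−1)^{n·(p mod m)}`, low rungs `(−1)^a`, high digits
  `hsign^{m·e + r} = hsign^p`; the parities agree because `n(n+1)` is even, `sign_exponent_mod_two`), so consecutive grid terms alternate;
* **`grid_le_of_tropRootLawAt (A E m B) : TropRootLawAt m ((A+1)(E+1)) B → (A·m+1)(E·m+1) − 1 ≤ B`** for every `m`, `A`, `E`;
* **`gap_rankTwo_row_iff (A E m B)`**: among `(m, (A+1)(E+1))` designs with exponents `d l = d₀ + a₁(l)·g₁ + a₂(l)·g₂`, digits `a₁ ≤ A`, `a₂ ≤ E`,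
  a number `B` bounds every dominant sign-alternating chain iff `(A·m+1)(E·m+1) − 1 ≤ B` — val-sym-trop-p1's ceiling
  `KPlusLogSqLaw.Sumset.chain_succ_le_of_gap` (`∏_j (m·A_j+1)`, rank two) is ATTAINED for all digit bounds and all sizes.  Special cases:
  `E = 1` = `gapTwo_row_iff` (SHIFT-LADDER), `A = E = 1` = `parallelogram_row_four_iff` (SHIFT-SQUARE), `A = 0` = the arithmetic-progression
  row `ShiftLadder`/`Sumset.chain_le_of_ap` (`T = E·m`), `A = E = 2` gives `T(m,9) ≥ 4m² + 4m`.
Reading (no claim beyond the theorems): the rank-two generalized-arithmetic-progression sectors of the tropical census are exactly solved,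
all quadratic in `m`; the product ceiling `∏_j (m·A_j+1)` is first open at rank THREE, where attaining it would be a cubic all-`m` family — the
cell's open digit question in GAP dress (this mechanism has one phase parameter and does not reach it).  Nothing here bears on `TropicalB` /
`WeakLifting` in their window, the `K = 4` fork, `MatrixDescartes` (stmt-ValiantsHypothesis-18050) or `VP ≠ VNP`.
-/

set_option linter.dupNamespace false
set_option autoImplicit false

namespace Summit.ValiantsHypothesis.ValiantsHypothesis.Theorems.LacunarySymmetroidMatrixDescartes.TropicalCensus

open Summit.ValiantsHypothesis.ValiantsHypothesis.Theorems.MatrixDescartes.Negative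
open scoped BigOperators
open Finset

namespace ShiftGrid

open ShiftThree (shiftZ)
open ShiftSquare (rot)
open ShiftLadder (width kap bigD pen priceSum hsign th lvl gval bonus grid)

variable (A E n : ℕ)

/-! ### identification of an incidence by its effective shift -/

/-- an incidence with effective shift `p ≤ E·m` sits on the phase's entry of its column and has the grid's high digit. -/
theorem cell_of_eshift_eq (p a : ℕ) (hp : p ≤ E * (n + 1)) (a' b : Fin (n + 1)) (l : Fin ((A + 1) * (E + 1)))
    (hq : eshift A E n a' b l = p) :
    a' = rot n (p % (n + 1)) b ∧ hi A E l = hi A E (lam A E n p a b) := by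
  rw [hi_lam, min_eq_right (hlv_le E n p hp b)]
  unfold eshift at hq
  obtain ⟨hs0, hs1⟩ := ShiftSquare.shiftZ_bounds n a' b
  have h := Nat.div_add_mod p (n + 1)
  have hr := mod_lt' n p
  set e := p / (n + 1) with he
  set r := p % (n + 1) with hr'
  have hp' : (p : ℤ) = ((n : ℤ) + 1) * e + r := by
    have : ((n + 1) * e + r : ℕ) = p := h
    exact_mod_cast this.symm
  set w : ℤ := (if (a' : ℕ) < (b : ℕ) then 1 else 0) with hw
  have hw01 : 0 ≤ w ∧ w ≤ 1 := by rw [hw]; split_ifs <;> constructor <;> norm_num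
  -- `shift − r = (n+1)·(e − (hi − w))`, with `|shift − r| ≤ n`: both sides vanish
  have hkey : shiftZ n a' b - r = ((n : ℤ) + 1) * ((e : ℤ) - ((hi A E l : ℤ) - w)) := by linarith
  have ht : (e : ℤ) - ((hi A E l : ℤ) - w) = 0 := by
    rcases lt_trichotomy ((e : ℤ) - ((hi A E l : ℤ) - w)) 0 with hlt | heq | hgt
    · exfalso
      have : ((n : ℤ) + 1) * ((e : ℤ) - ((hi A E l : ℤ) - w)) ≤ ((n : ℤ) + 1) * (-1) :=
        mul_le_mul_of_nonneg_left (by linarith) (by positivity)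
      have hr0 : (0 : ℤ) ≤ (r : ℤ) := by positivity
      linarith
    · exact heq
    · exfalso
      have : ((n : ℤ) + 1) * 1 ≤ ((n : ℤ) + 1) * ((e : ℤ) - ((hi A E l : ℤ) - w)) :=
        mul_le_mul_of_nonneg_left (by linarith) (by positivity)
      have hrn : (r : ℤ) ≤ n := by exact_mod_cast Nat.lt_succ_iff.mp hr
      linarith
  have hsr : shiftZ n a' b = r := by rw [ht, mul_zero] at hkey; linarith
  have ha' : a' = rot n r b := ShiftSquare.eq_rot_of_shiftZ_eq_of_lt n r hr a' b hsr
  refine ⟨ha', ?_⟩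
  -- the high digit: `hi = e + w`, and `w` is the grid entry's wrap indicator
  unfold hlv
  have hwrap : ((a' : ℕ) < (b : ℕ)) ↔ n + 1 ≤ (b : ℕ) + r := by rw [ha']; exact wrap_cterm_iff n p b
  have hhi : (hi A E l : ℤ) = e + w := by linarith
  by_cases hab : (a' : ℕ) < (b : ℕ)
  · rw [if_pos (hwrap.mp hab)]
    rw [hw, if_pos hab] at hhi
    exact_mod_cast hhi
  · rw [if_neg (fun h' => hab (hwrap.mpr h'))]
    rw [hw, if_neg hab] at hhi
    exact_mod_cast hhi

/-! ### per-incidence domination -/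

/-- **per-incidence domination**: at `θ(p,a)` (`p ≤ E·m`, `a ≤ A·m`) every incidence of column `b` scores at most the grid term's
incidence … -/
theorem phi_le (p a : ℕ) (hp : p ≤ E * (n + 1)) (ha : a ≤ A * (n + 1)) (a' b : Fin (n + 1)) (l : Fin ((A + 1) * (E + 1))) :
    phi A E n (th A n p a) a' b l ≤ phi A E n (th A n p a) (rot n (p % (n + 1)) b) b (lam A E n p a b) := by
  rw [phi_eq, phi_cterm A E n _ p a hp ha b]
  have hlo := lo_le A E l
  have hloz : (0 : ℤ) ≤ (lo A E l : ℤ) := by positivity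
  have hloA : (lo A E l : ℤ) ≤ A := by exact_mod_cast hlo
  have hW : (0 : ℤ) ≤ (width A n : ℤ) := by positivity
  have hB := ShiftLadder.bonus_le_lvl A n p a ha b (lo A E l)
  set q := eshift A E n a' b l with hq
  rcases lt_trichotomy q p with hlt | heq | hgt
  · have h1 := ShiftLadder.gval_gap_of_lt A n p a q hlt
    have h2 := ShiftLadder.bonus_shift A n (th A n p a) p q b (lo A E l)
    have h3 : (lo A E l : ℤ) * (2 * (width A n : ℤ) * ((p : ℤ) - q)) ≤ (A : ℤ) * (2 * (width A n : ℤ) * ((p : ℤ) - q)) :=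
      mul_le_mul_of_nonneg_right hloA (by nlinarith)
    nlinarith
  · rw [heq]
    linarith
  · have h1 := ShiftLadder.gval_gap_of_gt A n p a ha q hgt
    have h2 := ShiftLadder.bonus_shift A n (th A n p a) p q b (lo A E l)
    have h3 : (lo A E l : ℤ) * (2 * (width A n : ℤ) * ((p : ℤ) - q)) ≤ 0 :=
      mul_nonpos_of_nonneg_of_nonpos hloz (by nlinarith)
    nlinarith

/-- … and strictly less unless it IS the grid term's incidence. -/
theorem phi_lt (p a : ℕ) (hp : p ≤ E * (n + 1)) (ha : a ≤ A * (n + 1)) (a' b : Fin (n + 1)) (l : Fin ((A + 1) * (E + 1)))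
    (hne : a' ≠ rot n (p % (n + 1)) b ∨ l ≠ lam A E n p a b) :
    phi A E n (th A n p a) a' b l < phi A E n (th A n p a) (rot n (p % (n + 1)) b) b (lam A E n p a b) := by
  rw [phi_eq, phi_cterm A E n _ p a hp ha b]
  have hlo := lo_le A E l
  have hloz : (0 : ℤ) ≤ (lo A E l : ℤ) := by positivity
  have hloA : (lo A E l : ℤ) ≤ A := by exact_mod_cast hlo
  have hW : (0 : ℤ) ≤ (width A n : ℤ) := by positivity
  have hB := ShiftLadder.bonus_le_lvl A n p a ha b (lo A E l)
  set q := eshift A E n a' b l with hq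
  rcases lt_trichotomy q p with hlt | heq | hgt
  · have h1 := ShiftLadder.gval_gap_of_lt A n p a q hlt
    have h2 := ShiftLadder.bonus_shift A n (th A n p a) p q b (lo A E l)
    have h3 : (lo A E l : ℤ) * (2 * (width A n : ℤ) * ((p : ℤ) - q)) ≤ (A : ℤ) * (2 * (width A n : ℤ) * ((p : ℤ) - q)) :=
      mul_le_mul_of_nonneg_right hloA (by nlinarith)
    nlinarith
  · have heq' : eshift A E n a' b l = p := by rw [← hq]; exact heq
    obtain ⟨ha', hhi⟩ := cell_of_eshift_eq A E n p a hp a' b l heq'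
    have hl : l ≠ lam A E n p a b := by
      rcases hne with h1 | h1
      · exact absurd ha' h1
      · exact h1
    have hlo' : lo A E l ≠ lvl n a b := by
      intro hc
      apply hl
      apply eq_of_digits A E
      · rw [hc, lo_lam, min_eq_right (ShiftLadder.lvl_le A n a ha b)]
      · exact hhi
    rw [heq]
    have h2 := ShiftLadder.bonus_lt_lvl A n p a ha b (lo A E l) hlo'
    linarith
  · have h1 := ShiftLadder.gval_gap_of_gt A n p a ha q hgt
    have h2 := ShiftLadder.bonus_shift A n (th A n p a) p q b (lo A E l)
    have h3 : (lo A E l : ℤ) * (2 * (width A n : ℤ) * ((p : ℤ) - q)) ≤ 0 :=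
      mul_nonpos_of_nonneg_of_nonpos hloz (by nlinarith)
    nlinarith

/-! ### dominance and signs of the grid terms -/

/-- **the grid term of `(p, a)` is the unique optimum at `θ(p,a)`**, for all `p ≤ E·m`, `a ≤ A·m`. -/
theorem isDominant_cterm (p a : ℕ) (hp : p ≤ E * (n + 1)) (ha : a ≤ A * (n + 1)) :
    IsDominant (dd A E n) (vv A E n) (ee A E n) (th A n p a) (cterm A E n p a) := by
  refine ⟨?_, ?_⟩
  · unfold termSign cterm
    refine mul_ne_zero (Units.ne_zero _) ?_
    rw [Finset.prod_ne_zero_iff]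
    intro b _
    exact ee_ne_zero A E n _ b _
  · intro q hq _
    rw [tropWeight_eq_sum_phi, tropWeight_eq_sum_phi]
    obtain ⟨b₀, hb₀⟩ : ∃ b, q.1 b ≠ rot n (p % (n + 1)) b ∨ q.2 b ≠ lam A E n p a b := by
      by_contra hcon
      push Not at hcon
      apply hq
      unfold cterm
      exact Prod.ext (Equiv.ext fun b => (hcon b).1) (funext fun b => (hcon b).2)
    unfold cterm
    exact Finset.sum_lt_sum (fun b _ => phi_le A E n p a hp ha (q.1 b) b (q.2 b))
      ⟨b₀, Finset.mem_univ _, phi_lt A E n p a hp ha (q.1 b₀) b₀ (q.2 b₀) hb₀⟩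

/-- an exponent identity behind the sign bookkeeping: with `p = m·e + r`,
`n·r + a + (A+1)m·(m·e + r)` and `W·(m·e + r) + a` differ by the even number `2nr + n(n+1)·e`; we only need them modulo `2`. -/
theorem sign_exponent_mod_two (e r a : ℕ) :
    (n * r + a + (A + 1) * (n + 1) * ((n + 1) * e + r)) % 2 = (width A n * ((n + 1) * e + r) + a) % 2 := by
  unfold ShiftLadder.width
  obtain ⟨c, hc⟩ := Nat.even_mul_succ_self n
  have e1 : n * r + a + (A + 1) * (n + 1) * ((n + 1) * e + r)
      = ((A * (n + 1) + 1) * ((n + 1) * e + r) + a) + 2 * (n * r) + (n * (n + 1)) * e := by ring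
  have e3 : (c + c) * e = 2 * (c * e) := by ring
  rw [e1, hc, e3]
  omega

/-- **sign of the grid term**: `(−1)^{W·p + a}` (`p ≤ E·m`, `a ≤ A·m`). -/
theorem termSign_cterm (p a : ℕ) (hp : p ≤ E * (n + 1)) (ha : a ≤ A * (n + 1)) :
    termSign (ee A E n) (cterm A E n p a) = (-1) ^ (width A n * p + a) := by
  unfold termSign cterm ee
  dsimp only
  have hr := mod_lt' n p
  have h := Nat.div_add_mod p (n + 1)
  set e := p / (n + 1) with he
  set r := p % (n + 1) with hr'
  have h1 : ∀ b : Fin (n + 1), lsign A E n (lam A E n p a b) =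
      (-1 : ℤ) ^ lvl n a b * ((hsign A n) ^ e * (if n + 1 ≤ (b : ℕ) + r then hsign A n else 1)) := by
    intro b
    unfold lsign
    rw [lo_lam, hi_lam, min_eq_right (ShiftLadder.lvl_le A n a ha b), min_eq_right (hlv_le E n p hp b)]
    unfold hlv
    rw [pow_add]
    by_cases hw : n + 1 ≤ (b : ℕ) + r
    · rw [if_pos hw, if_pos hw, pow_one]
    · rw [if_neg hw, if_neg hw, pow_zero]
  rw [Finset.prod_congr rfl (fun b _ => h1 b), Finset.prod_mul_distrib, Finset.prod_mul_distrib,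
    ShiftLadder.prod_neg_one_pow_lvl, ShiftLadder.prod_ite_high n _ _ hr.le, Finset.prod_const, Finset.card_univ,
    Fintype.card_fin, ShiftSquare.sign_rot]
  unfold ShiftLadder.hsign
  rw [← pow_mul, ← pow_mul, ← pow_mul, ← pow_add, ← pow_add, ← pow_add, neg_one_pow_eq_pow_mod_two,
    neg_one_pow_eq_pow_mod_two (R := ℤ) (width A n * p + a)]
  congr 1
  rw [← h]
  have e2 : n * r + (a + ((A + 1) * (n + 1) * (e * (n + 1)) + (A + 1) * (n + 1) * r))
      = n * r + a + (A + 1) * (n + 1) * ((n + 1) * e + r) := by ring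
  rw [e2]
  exact sign_exponent_mod_two A n e r a

/-! ### the chain -/

/-- the grid point `k < (E·m + 1)·W` lies in `[0, E·m] × [0, A·m]`. -/
theorem grid_le (k : ℕ) (hk : k < (E * (n + 1) + 1) * width A n) : (grid A n k).1 ≤ E * (n + 1) ∧ (grid A n k).2 ≤ A * (n + 1) := by
  unfold ShiftLadder.grid
  dsimp only
  have hW := ShiftLadder.width_pos A n
  constructor
  · have : k / width A n < E * (n + 1) + 1 := Nat.div_lt_of_lt_mul (by rw [Nat.mul_comm]; exact hk)
    omega
  · have : k % width A n < width A n := Nat.mod_lt _ hW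
    unfold ShiftLadder.width at this ⊢
    omega

/-- the term signs alternate along the grid: the `k`-th sign is `(−1)^k`. -/
theorem termSign_grid (k : ℕ) (hk : k < (E * (n + 1) + 1) * width A n) :
    termSign (ee A E n) (cterm A E n (grid A n k).1 (grid A n k).2) = (-1) ^ k := by
  obtain ⟨h1, h2⟩ := grid_le A E n k hk
  rw [termSign_cterm A E n _ _ h1 h2]
  unfold ShiftLadder.grid
  dsimp only
  rw [Nat.div_add_mod k (width A n)]

/-- **the tropical row `(m, (A+1)(E+1))`, `m = n + 1`, is at least `(E·m + 1)·(A·m + 1) − 1`.** -/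
theorem le_of_tropRootLawAt_succ (B : ℕ) (h : TropRootLawAt (n + 1) ((A + 1) * (E + 1)) B) :
    (E * (n + 1) + 1) * width A n - 1 ≤ B := by
  have hN : 1 ≤ (E * (n + 1) + 1) * width A n :=
    Nat.one_le_iff_ne_zero.mpr (Nat.mul_ne_zero (by omega) (ShiftLadder.width_pos A n).ne')
  have hmain := h (dd A E n) (vv A E n) (ee A E n) ((E * (n + 1) + 1) * width A n - 1)
    (fun k => th A n (grid A n k).1 (grid A n k).2)
    (fun k => cterm A E n (grid A n k).1 (grid A n k).2) (ee_natAbs A E n) ?_ ?_ ?_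
  · exact hmain
  · refine Fin.strictMono_iff_lt_succ.mpr fun k => ?_
    simp only [Fin.val_castSucc, Fin.val_succ]
    exact ShiftLadder.th_grid_lt A n k
  · intro k
    obtain ⟨h1, h2⟩ := grid_le A E n k (by omega)
    exact isDominant_cterm A E n _ _ h1 h2
  · intro k
    simp only [Fin.val_castSucc, Fin.val_succ]
    rw [termSign_grid A E n k (by omega), termSign_grid A E n (k + 1) (by omega), ← pow_add,
      show (k : ℕ) + (k + 1) = 2 * k + 1 by ring, pow_succ, pow_mul]
    norm_num

end ShiftGrid

/-- **The `K = (A+1)(E+1)` tropical census row is at least `(A·m + 1)(E·m + 1) − 1` for EVERY `m`, `A`, `E`** — the explicit SHIFT-GRID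
design (full support; `A + 1` low rungs times `E + 1` high eras on the rotation skeleton).  `E = 1`: SHIFT-LADDER's `(A·m+1)(m+1) − 1`;
`A = E = 1`: SHIFT-SQUARE's `m² + 2m`; `A = 0`: `T(m, E+1) ≥ E·m`, the arithmetic-progression row; `A = E = 2` (`K = 9`): `T(m,9) ≥ 4m² + 4m`. -/
theorem grid_le_of_tropRootLawAt (A E m B : ℕ) (h : TropRootLawAt m ((A + 1) * (E + 1)) B) :
    (A * m + 1) * (E * m + 1) - 1 ≤ B := by
  rcases m with _ | n
  · simp
  · have h1 := ShiftGrid.le_of_tropRootLawAt_succ A E n B h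
    unfold ShiftLadder.width at h1
    have e : (A * (n + 1) + 1) * (E * (n + 1) + 1) = (E * (n + 1) + 1) * (A * (n + 1) + 1) := by ring
    rw [e]
    exact h1

/-- **EVERY RANK-TWO GAP ROW IS EXACTLY `(A·m + 1)(E·m + 1) − 1`.**  Among designs of format `(m, (A+1)(E+1))` whose exponents lie in a
generalized arithmetic progression of rank two, `d l = d₀ + a₁(l)·g₁ + a₂(l)·g₂` with digits `a₁(l) ≤ A`, `a₂(l) ≤ E`, a number `B` bounds
the sign changes of every dominant sign-alternating chain iff `(A·m + 1)(E·m + 1) − 1 ≤ B`: the ceiling is val-sym-trop-p1's sumset law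
`KPlusLogSqLaw.Sumset.chain_succ_le_of_gap` (`∏_j (m·A_j + 1)`), the floor is SHIFT-GRID (exponents `j + h·D`, `j ≤ A`, `h ≤ E`).  So the
rank-two GAP sectors of the tropical census are exactly solved, for all digit bounds and all sizes; the product ceiling is first open at
rank three (a cubic all-`m` family). -/
theorem gap_rankTwo_row_iff (A E m B : ℕ) :
    (∀ (d : Fin ((A + 1) * (E + 1)) → ℕ) (d₀ g₁ g₂ : ℕ) (a₁ a₂ : Fin ((A + 1) * (E + 1)) → ℕ), (∀ l, a₁ l ≤ A) → (∀ l, a₂ l ≤ E) →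
        (∀ l, d l = d₀ + a₁ l * g₁ + a₂ l * g₂) →
        ∀ (v ε : Fin m → Fin m → Fin ((A + 1) * (E + 1)) → ℤ) (N : ℕ) (θ : Fin (N + 1) → ℤ)
          (p : Fin (N + 1) → Equiv.Perm (Fin m) × (Fin m → Fin ((A + 1) * (E + 1)))),
          (∀ i j l, (ε i j l).natAbs ≤ 1) → StrictMono θ → (∀ k, IsDominant d v ε (θ k) (p k)) →
          (∀ k : Fin N, termSign ε (p k.castSucc) * termSign ε (p k.succ) < 0) → N ≤ B) ↔
      (A * m + 1) * (E * m + 1) - 1 ≤ B := by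
  constructor
  · intro h
    rcases m with _ | n
    · simp
    · have hW := ShiftLadder.width_pos A n
      have hN : 1 ≤ (E * (n + 1) + 1) * ShiftLadder.width A n := Nat.one_le_iff_ne_zero.mpr (Nat.mul_ne_zero (by omega) hW.ne')
      have hmain := h (ShiftGrid.dd A E n) 0 1 (ShiftLadder.bigD A n) (ShiftGrid.lo A E) (ShiftGrid.hi A E)
        (ShiftGrid.lo_le A E) (ShiftGrid.hi_le A E) (fun l => by unfold ShiftGrid.dd; ring)
        (ShiftGrid.vv A E n) (ShiftGrid.ee A E n) ((E * (n + 1) + 1) * ShiftLadder.width A n - 1)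
        (fun k => ShiftLadder.th A n (ShiftLadder.grid A n k).1 (ShiftLadder.grid A n k).2)
        (fun k => ShiftGrid.cterm A E n (ShiftLadder.grid A n k).1 (ShiftLadder.grid A n k).2) (ShiftGrid.ee_natAbs A E n)
        ?_ ?_ ?_
      · unfold ShiftLadder.width at hmain
        have e : (A * (n + 1) + 1) * (E * (n + 1) + 1) = (E * (n + 1) + 1) * (A * (n + 1) + 1) := by ring
        rw [e]; exact hmain
      · refine Fin.strictMono_iff_lt_succ.mpr fun k => ?_
        simp only [Fin.val_castSucc, Fin.val_succ]
        exact ShiftLadder.th_grid_lt A n k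
      · intro k
        obtain ⟨h1, h2⟩ := ShiftGrid.grid_le A E n k (by omega)
        exact ShiftGrid.isDominant_cterm A E n _ _ h1 h2
      · intro k
        simp only [Fin.val_castSucc, Fin.val_succ]
        rw [ShiftGrid.termSign_grid A E n k (by omega), ShiftGrid.termSign_grid A E n (k + 1) (by omega), ← pow_add,
          show (k : ℕ) + (k + 1) = 2 * k + 1 by ring, pow_succ, pow_mul]
        norm_num
  · intro hB d d₀ g₁ g₂ a₁ a₂ h₁ h₂ hd v ε N θ p hε hθ hdom halt
    have h := KPlusLogSqLaw.Sumset.chain_succ_le_of_gap d v ε θ p hθ hdom halt (r := 2) d₀ ![g₁, g₂] ![A, E]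
      (fun l => ![a₁ l, a₂ l]) ?_ ?_
    · rw [Fin.prod_univ_two] at h
      simp only [Matrix.cons_val_zero, Matrix.cons_val_one] at h
      have e : (m * A + 1) * (m * E + 1) = (A * m + 1) * (E * m + 1) := by ring
      rw [e] at h
      omega
    · intro l j
      fin_cases j
      · exact h₁ l
      · exact h₂ l
    · intro l
      rw [hd l, Fin.sum_univ_two]
      simp only [Matrix.cons_val_zero, Matrix.cons_val_one]
      ring



end Summit.ValiantsHypothesis.ValiantsHypothesis.Theorems.LacunarySymmetroidMatrixDescartes.TropicalCensus
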